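import Mathlib

/-!
# PercRepro — LEMMA m: a simple matroid of rank `k` on `g` elements has at least `C(g − k + 2, 2)` bases (night-1, gen 1)

`proofs/NIGHT-1-C025-induction.md` §13.4 (the lemma behind the 4-circuit count that closes residue (R1) of THEOREM E).
«Simple» is taken in the form used throughout the cell: every circuit has at least `3` elements (no loops, no parallel
pairs). The proof is the five-line induction of the dossier: for a non-coloop `x` the bases split into those avoiding
`x` (the bases of `M.delete {x}`, a simple matroid of the same rank on `g − 1` elements) and those through `x`, of which
there are at least `g − k + 1`: fix a base `B₀ ∋ x`; for each `y ∉ B₀` the fundamental circuit of `y` has a third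
element `b ∉ {x, y}`, and `insert y B₀ \ {b}` is a base through `x`, distinct for distinct `y`.

* `exists_isBase_insert_sdiff` — the exchange step with a third element of the fundamental circuit;
* `ncard_isBase_mem_ge` — at least `|E| − |B₀| + 1` bases through `x ∈ B₀`;
* `isBase_delete_singleton_iff` — the bases of `M.delete {x}` are the bases of `M` avoiding a non-coloop `x`;
* **`choose_two_le_ncard_isBase`** — LEMMA m.
Axioms: standard.
-/

namespace PercRepro

namespace Matroid

open Set

variable {α : Type*} {M : _root_.Matroid α}

/-- **The exchange step**: for a base `B₀`, a point `y ∉ B₀` of the ground set, and any `x`, if every circuit has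
`≥ 3` elements then some `b ∈ B₀ ∖ {x}` makes `insert y B₀ \ {b}` a base (a third element of the fundamental circuit
of `y` with respect to `B₀`). -/
theorem exists_isBase_insert_sdiff (hcirc : ∀ C, M.IsCircuit C → 3 ≤ C.encard) {B₀ : Set α}
    (hB₀ : M.IsBase B₀) {x y : α} (hyE : y ∈ M.E) (hyB : y ∉ B₀) :
    ∃ b ∈ B₀, b ≠ x ∧ M.IsBase (insert y B₀ \ {b}) := by
  have hC := hB₀.fundCircuit_isCircuit hyE hyB
  have hsub := M.fundCircuit_subset_insert y B₀
  have h3 := hcirc _ hC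
  -- the fundamental circuit is not inside `{x, y}`
  have hnot : ¬ M.fundCircuit y B₀ ⊆ ({x, y} : Set α) := by
    intro hss
    have := Set.encard_le_encard hss
    have h2 : ({x, y} : Set α).encard ≤ 2 := by
      calc ({x, y} : Set α).encard ≤ ({x} : Set α).encard + ({y} : Set α).encard :=
            Set.encard_union_le _ _
        _ = 2 := by rw [Set.encard_singleton, Set.encard_singleton, one_add_one_eq_two]
    have : (3 : ℕ∞) ≤ 2 := h3.trans (this.trans h2)
    exact absurd this (by norm_num)
  obtain ⟨b, hbC, hbxy⟩ := Set.not_subset.1 hnot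
  have hbx : b ≠ x := fun h => hbxy (by rw [h]; exact Set.mem_insert x {y})
  have hby : b ≠ y := fun h => hbxy (by rw [h]; exact Set.mem_insert_of_mem x (Set.mem_singleton y))
  have hbB : b ∈ B₀ := by
    rcases hsub hbC with h | h
    · exact absurd h hby
    · exact h
  have hycl : y ∈ M.closure B₀ := by rw [hB₀.closure_eq]; exact hyE
  have hind : M.Indep (insert y B₀ \ {b}) := (hB₀.indep.mem_fundCircuit_iff hycl hyB).1 hbC
  exact ⟨b, hbB, hbx, hB₀.exchange_isBase_of_indep' hbB hyB hind⟩

/-- **At least `|E| − |B₀| + 1` bases through `x`** when `x` lies in the base `B₀` and every circuit has `≥ 3`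
elements: `B₀` and, for every `y ∉ B₀`, the exchanged base `insert y B₀ \ {b_y}`. -/
theorem ncard_isBase_mem_ge [M.Finite] (hcirc : ∀ C, M.IsCircuit C → 3 ≤ C.encard) {B₀ : Set α}
    (hB₀ : M.IsBase B₀) {x : α} (hx : x ∈ B₀) :
    M.E.ncard - B₀.ncard + 1 ≤ {B : Set α | M.IsBase B ∧ x ∈ B}.ncard := by
  classical
  have hB₀E : B₀ ⊆ M.E := hB₀.subset_ground
  have hB₀fin : B₀.Finite := M.ground_finite.subset hB₀E
  -- the choice of the exchanged element for `y ∈ E ∖ B₀`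
  have hex : ∀ y ∈ M.E \ B₀, ∃ b ∈ B₀, b ≠ x ∧ M.IsBase (insert y B₀ \ {b}) :=
    fun y hy => exists_isBase_insert_sdiff hcirc hB₀ (x := x) hy.1 hy.2
  choose! b hb using hex
  set f : α → Set α := fun y => insert y B₀ \ {b y} with hf
  have hfmem : ∀ y ∈ M.E \ B₀, f y ∈ {B : Set α | M.IsBase B ∧ x ∈ B} := by
    intro y hy
    obtain ⟨hbB, hbx, hbase⟩ := hb y hy
    refine ⟨hbase, ?_⟩
    exact ⟨Set.mem_insert_of_mem y hx, fun h => hbx (Set.mem_singleton_iff.1 h).symm⟩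
  have hfinj : Set.InjOn f (M.E \ B₀) := by
    intro y hy y' hy' hyy'
    -- `y` is the unique element of `f y` outside `B₀`
    have hy1 : y ∈ f y := ⟨Set.mem_insert y B₀, fun h => hy.2 ((Set.mem_singleton_iff.1 h) ▸ (hb y hy).1)⟩
    rw [hyy'] at hy1
    rcases hy1.1 with h | h
    · exact h
    · exact absurd h hy.2
  have hfnot : B₀ ∉ f '' (M.E \ B₀) := by
    rintro ⟨y, hy, hfy⟩
    have : y ∈ B₀ := by
      rw [← hfy]
      exact ⟨Set.mem_insert y B₀, fun h => hy.2 ((Set.mem_singleton_iff.1 h) ▸ (hb y hy).1)⟩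
    exact hy.2 this
  have hEfin : (M.E \ B₀).Finite := M.ground_finite.sdiff
  have himg_fin : (f '' (M.E \ B₀)).Finite := hEfin.image f
  have hsub : insert B₀ (f '' (M.E \ B₀)) ⊆ {B : Set α | M.IsBase B ∧ x ∈ B} := by
    intro B hB
    rcases hB with rfl | ⟨y, hy, rfl⟩
    · exact ⟨hB₀, hx⟩
    · exact hfmem y hy
  have hset_fin : {B : Set α | M.IsBase B ∧ x ∈ B}.Finite :=
    M.ground_finite.finite_subsets.subset (fun B hB => hB.1.subset_ground)
  calc M.E.ncard - B₀.ncard + 1 = (M.E \ B₀).ncard + 1 := by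
        rw [Set.ncard_sdiff hB₀E hB₀fin]
    _ = (f '' (M.E \ B₀)).ncard + 1 := by rw [hfinj.ncard_image]
    _ = (insert B₀ (f '' (M.E \ B₀))).ncard := (Set.ncard_insert_of_notMem hfnot himg_fin).symm
    _ ≤ {B : Set α | M.IsBase B ∧ x ∈ B}.ncard := Set.ncard_le_ncard hsub hset_fin

/-- The bases of `M.delete {x}` for a non-coloop `x` are exactly the bases of `M` avoiding `x`. -/
theorem isBase_delete_singleton_iff {x : α} (hx : ¬ M.IsColoop x) {B : Set α} :
    (M.delete {x}).IsBase B ↔ M.IsBase B ∧ x ∉ B := by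
  have hsp : M.Spanning (M.E \ {x}) := by
    by_contra h
    exact hx (_root_.Matroid.isColoop_iff_sdiff_not_spanning.2 h)
  rw [_root_.Matroid.delete_isBase_iff]
  constructor
  · intro hB
    refine ⟨hB.isBase_of_spanning hsp, fun hxB => ?_⟩
    exact (hB.subset hxB).2 (Set.mem_singleton x)
  · rintro ⟨hB, hxB⟩
    refine hB.isBasis_of_subset (X := M.E \ {x}) Set.sdiff_subset ?_
    intro e he
    exact ⟨hB.subset_ground he, fun h => hxB ((Set.mem_singleton_iff.1 h) ▸ he)⟩

/-- **LEMMA m**: a finite matroid all of whose circuits have `≥ 3` elements, of rank `k` on `g` elements, has at least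
`C(g − k + 2, 2)` bases. -/
theorem choose_two_le_ncard_isBase [M.Finite] (hcirc : ∀ C, M.IsCircuit C → 3 ≤ C.encard) {k : ℕ}
    (hR : M.eRank = (k : ℕ∞)) :
    (M.E.ncard - k + 2).choose 2 ≤ {B : Set α | M.IsBase B}.ncard := by
  classical
  suffices H : ∀ n : ℕ, ∀ (M : _root_.Matroid α) [M.Finite], M.E.ncard = n →
      (∀ C, M.IsCircuit C → 3 ≤ C.encard) → ∀ k : ℕ, M.eRank = (k : ℕ∞) →
      (n - k + 2).choose 2 ≤ {B : Set α | M.IsBase B}.ncard from H _ M rfl hcirc k hR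
  intro n
  induction n using Nat.strong_induction_on with
  | _ n ih =>
  intro M _ hn hcirc k hR
  obtain ⟨B₀, hB₀⟩ := M.exists_isBase
  have hB₀E : B₀ ⊆ M.E := hB₀.subset_ground
  have hB₀fin : B₀.Finite := M.ground_finite.subset hB₀E
  have hB₀k : B₀.ncard = k := by
    have h := hB₀.encard_eq_eRank
    rw [hR, ← hB₀fin.cast_ncard_eq] at h
    exact_mod_cast h
  have hkn : k ≤ n := by rw [← hB₀k, ← hn]; exact Set.ncard_le_ncard hB₀E M.ground_finite
  have hfin_bases : {B : Set α | M.IsBase B}.Finite :=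
    M.ground_finite.finite_subsets.subset (fun B hB => hB.subset_ground)
  by_cases hEB : M.E ⊆ B₀
  · -- `E = B₀`: the only base is `E`; `n = k`
    have hEeq : M.E = B₀ := Set.Subset.antisymm hEB hB₀E
    have hnk : n = k := by rw [← hn, ← hB₀k, hEeq]
    have hsingle : {B : Set α | M.IsBase B} = {B₀} := by
      ext B
      simp only [Set.mem_setOf_eq, Set.mem_singleton_iff]
      constructor
      · intro hB
        exact hB.eq_of_subset_indep hB₀.indep (hB.subset_ground.trans hEB)
      · rintro rfl
        exact hB₀
    rw [hsingle, Set.ncard_singleton, hnk, Nat.sub_self]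
    norm_num
  · -- a point `y ∉ B₀`; an element `x ≠ y` of its fundamental circuit lies in `B₀` and is not a coloop
    obtain ⟨y, hyE, hyB⟩ := Set.not_subset.1 hEB
    have hC := hB₀.fundCircuit_isCircuit hyE hyB
    have hCsub := M.fundCircuit_subset_insert y B₀
    have hnot : ¬ M.fundCircuit y B₀ ⊆ ({y} : Set α) := by
      intro hss
      have h1 := (Set.encard_le_encard hss).trans_eq (Set.encard_singleton y)
      have h3 := hcirc _ hC
      have : (3 : ℕ∞) ≤ 1 := h3.trans h1
      exact absurd this (by norm_num)
    obtain ⟨x, hxC, hxy⟩ := Set.not_subset.1 hnot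
    have hxy' : x ≠ y := fun h => hxy (h ▸ Set.mem_singleton x)
    have hxB : x ∈ B₀ := by
      rcases hCsub hxC with h | h
      · exact absurd h hxy'
      · exact h
    have hxE : x ∈ M.E := hB₀E hxB
    have hxcol : ¬ M.IsColoop x := fun h => h.notMem_isCircuit hC hxC
    have hsp : M.Spanning (M.E \ {x}) := by
      by_contra h
      exact hxcol (_root_.Matroid.isColoop_iff_sdiff_not_spanning.2 h)
    -- `n ≥ k + 1`
    have hkn' : k + 1 ≤ n := by
      have hins : insert y B₀ ⊆ M.E := Set.insert_subset hyE hB₀E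
      have := Set.ncard_le_ncard hins M.ground_finite
      rw [Set.ncard_insert_of_notMem hyB hB₀fin, hB₀k, hn] at this
      exact this
    -- the split of the bases along `x`
    have hsplit : ({B : Set α | M.IsBase B} ∩ {B : Set α | x ∈ B}).ncard +
        ({B : Set α | M.IsBase B} \ {B : Set α | x ∈ B}).ncard = {B : Set α | M.IsBase B}.ncard :=
      Set.ncard_inter_add_ncard_sdiff_eq_ncard _ _ hfin_bases
    have hin : {B : Set α | M.IsBase B} ∩ {B : Set α | x ∈ B} = {B : Set α | M.IsBase B ∧ x ∈ B} := by
      ext B; simp only [Set.mem_inter_iff, Set.mem_setOf_eq]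
    have hout : {B : Set α | M.IsBase B} \ {B : Set α | x ∈ B} = {B : Set α | (M.delete {x}).IsBase B} := by
      ext B
      simp only [Set.mem_sdiff, Set.mem_setOf_eq]
      rw [isBase_delete_singleton_iff hxcol]
    -- the bases through `x`
    have h1 : n - k + 1 ≤ {B : Set α | M.IsBase B ∧ x ∈ B}.ncard := by
      have := ncard_isBase_mem_ge hcirc hB₀ hxB
      rwa [hn, hB₀k] at this
    -- the bases avoiding `x`: the induction hypothesis for `M.delete {x}`
    have hn' : (M.delete {x}).E.ncard = n - 1 := by
      rw [_root_.Matroid.delete_ground, Set.ncard_sdiff_singleton_of_mem hxE, hn]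
    have hcirc' : ∀ C, (M.delete {x}).IsCircuit C → 3 ≤ C.encard := by
      intro C hC'
      rw [_root_.Matroid.delete_isCircuit_iff] at hC'
      exact hcirc C hC'.1
    have hR' : (M.delete {x}).eRank = (k : ℕ∞) := by
      rw [_root_.Matroid.eRank_def, _root_.Matroid.delete_ground, _root_.Matroid.delete_eq_restrict,
        _root_.Matroid.restrict_eRk_eq', Set.inter_self, hsp.eRk_eq, hR]
    have h2 := ih (n - 1) (by omega) (M.delete {x}) hn' hcirc' k hR'
    -- assemble: `C(n−k+2, 2) = C(n−k+1, 2) + (n−k+1)`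
    rw [← hsplit, hin, hout]
    have e1 : (n - k + 2).choose 2 = (n - 1 - k + 2).choose 2 + (n - k + 1) := by
      obtain ⟨m, hm⟩ : ∃ m, n = k + 1 + m := ⟨n - (k + 1), by omega⟩
      have e2 : n - k + 2 = m + 2 + 1 := by omega
      have e3 : n - 1 - k + 2 = m + 2 := by omega
      have e4 : n - k + 1 = m + 2 := by omega
      have h5 := Nat.choose_succ_succ' (m + 2) 1
      simp only [Nat.choose_one_right, Nat.reduceAdd] at h5
      rw [e2, e3, e4]
      omega
    rw [e1]
    omega

end Matroid

end PercRepro
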